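import Literature.NumberTheory.EllipticCurves.CongruentNumberCurveLValueKronecker
import Mathlib.Tactic.NormNum.LegendreSymbol
import HarnessLib

/-!
# `L(E₂, 1) = β/(2√2)` and `L(E₁, 1) = β/4` for the congruent number curves

Topic `Literature/NumberTheory/EllipticCurves` (Tunnell cluster). Proof file for the named facts
`Literature.NumberTheory.EllipticCurves.BirchSwinnertonDyer1965_L_one_two_ten` (first conjunct:
`L(E₂, 1) = β/(2√2)`) and `…BirchSwinnertonDyer1965_L_one_one_three` (first conjunct:
`L(E₁, 1) = β/4`) of `BSDAnalyticRankTunnellWaldspurgerProofs` — the CM `L`-values fixing the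
constants `γ₁`, `β₁` in Tunnell's Theorem 3 (Invent. Math. 72 (1983), p. 329: "`L(E, 1)/β = 1/4`",
"comparing with the tables of [3] to find `L(E², 1)`"; Birch–Swinnerton-Dyer, Crelle 218 (1965),
Table 1). Both values are **proved** here (`entireLFunction_congruentNumberCurve_two_one`,
`entireLFunction_congruentNumberCurve_one_one`; packaged as the implications
`BirchSwinnertonDyer1965_L_one_two`, `BirchSwinnertonDyer1965_L_one_one` in the shape of the
facts' conjuncts). The second conjuncts (`L(E₁₀, 1) = 2β/√10`, `L(E₃, 1) = β/√3`) need the `20`-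
and `12`-division values of the lemniscatic `℘` and are not treated here.

## Proof

By `CongruentNumberCurveLValueKronecker`,
`L(E_n, 1) = (4M)⁻¹ Σ_{c ∈ ℤ[i]/M} ψ_n(c) conj E₁*(c/M)` for any period `M` of
`ψ_n = heckePsi n = (n/N(·)) u(·)`. For `n = 1, 2` the period `M = 4` suffices
(`heckePsi_two_add_four_mul`: `(2/N(x))` depends on `N(x) mod 8`, i.e. on `x mod 4`). Of the
sixteen classes modulo `4` the eight even ones have `u = 0`; the eight odd ones form the unit
orbits of `1` and of `3 + 2i`, with (`primaryUnit_values`, `heckePsi_two_values`)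
`ψ₂ = 1, −1, −i, i` on `1, 3, i, 3i` (`(2/1) = (2/9) = 1`) and `ψ₂ = 1, −1, −i, i` on
`1+2i, 3+2i, 2+i, 2+3i` (`(2/5) = (2/13) = −1`), while `E₁*` at the corresponding quarter points is
`B₁, −B₁, −iB₁, iB₁` and `−B₂, B₂, iB₂, −iB₂` (`kroneckerE₁_quarter_classes`, from
`E₁*(iz) = −iE₁*(z)`, oddness and `Λ`-periodicity; `B₁ = E₁*(1/4) = (1 + √2)ϖ₀/2`,
`B₂ = E₁*((3+2i)/4) = (1 − √2)ϖ₀/2`, `GaussianLatticeQuarterValues`). Hence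
`Σ_c ψ₂(c) conj E₁*(c/4) = 4B₁ − 4B₂ = 4√2ϖ₀` and `L(E₂, 1) = 4√2ϖ₀/16 = ϖ₀/(2√2)`; likewise
`Σ_c u(c) conj E₁*(c/4) = 4B₁ + 4B₂ = 4ϖ₀`, `L(E₁, 1) = ϖ₀/4`; and `ϖ₀ = Γ(1/4)²/(2√(2π)) = β`
(`tunnellPeriod_eq_varpi`, from `Literature.Analysis.SpecialFunctions.LemniscateConstant`).
Numerically `L(E₁, 1) = 0.65551…`, `L(E₂, 1) = 0.92703…` (LMFDB 32.a3, 64.a4).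

## References

* J. B. Tunnell, *A classical Diophantine problem and modular forms of weight 3/2*, Invent. Math.
  72 (1983) 323–334, proof of Thm 3, p. 329.
* B. J. Birch, H. P. F. Swinnerton-Dyer, *Notes on elliptic curves. II*, J. reine angew. Math. 218
  (1965) 79–108, (1.6) and Table 1 (`σ(1) = 1/4`; `σ = 1/2` for `Γ₄`).
-/

noncomputable section

open Complex Real Set Filter Topology PeriodPair
open scoped Real Topology PeriodPair ComplexConjugate

namespace Literature.NumberTheory.EllipticCurves

open Literature.NumberTheory.LFunctions Literature.NumberTheory.LFunctions.GaussianTheta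
  GaussianLattice GaussianPrimary Literature.NumberTheory.QuadraticFields.GaussianPrimary

local notation "Λᵢ" => PeriodPair.ofUpperHalfPlane UpperHalfPlane.I

local notation "ℤ[i]" => GaussianInt

/-- The lemniscatic constant `ϖ₀ = Γ(1/4)²/(2√(2π))`, local notation. -/
local notation "ϖ₀" => (Real.Gamma (1 / 4) ^ 2 / (2 * Real.sqrt (2 * π)) : ℝ)

/-! ### `tunnellPeriod = ϖ₀` -/

/-- **Tunnell's `β = ∫₁^∞ dx/√(x³ − x)` is `ϖ₀ = Γ(1/4)²/(2√(2π))`**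
(`Literature.Analysis.SpecialFunctions.integral_Ioi_one_inv_sqrt_cube_sub_self`). [folklore] -/
theorem tunnellPeriod_eq_varpi : tunnellPeriod = ϖ₀ := by
  rw [tunnellPeriod_def, Literature.Analysis.SpecialFunctions.integral_Ioi_one_inv_sqrt_cube_sub_self]

/-! ### `ψ₂` is periodic modulo `4` -/

/-- `N(x + 4y) ≡ N(x) (mod 8)`. [folklore] -/
theorem norm_add_four_mul_emod_eight (x y : ℤ[i]) :
    (x + 4 * y).norm % 8 = x.norm % 8 := by
  have : (x + 4 * y).norm = x.norm + 8 * (x.re * y.re + x.im * y.im + 2 * (y.re * y.re + y.im * y.im)) := by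
    simp only [Zsqrtd.norm_def, Zsqrtd.re_add, Zsqrtd.im_add, Zsqrtd.re_mul, Zsqrtd.im_mul]
    have h1 : (4 : ℤ[i]).re = 4 := rfl
    have h2 : (4 : ℤ[i]).im = 0 := rfl
    rw [h1, h2]
    ring
  rw [this, Int.add_mul_emod_self_left]

/-- **`ψ₂ = heckePsi 2` is periodic modulo `4`** (not only modulo `8`): the unit part depends on
`x mod 4`, and `(2/N(x))` on `N(x) mod 8`, which depends on `x mod 4`. [folklore] -/
theorem heckePsi_two_add_four_mul (x y : ℤ[i]) :
    heckePsi 2 (x + ((4 : ℕ) : ℤ[i]) * y) = heckePsi 2 x := by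
  have h4 : ((4 : ℕ) : ℤ[i]) = 4 := by norm_num
  rw [h4]
  unfold heckePsi
  have hu : primaryUnit (x + 4 * y) = primaryUnit x := by
    have := primaryUnit_add_natCast_mul (M := 4) dvd_rfl x y
    rwa [h4] at this
  rw [hu]
  by_cases hodd : (x.re + x.im) % 2 = 1
  · congr 2
    have hx2 : x.norm % 2 = 1 := by rw [norm_emod_two]; exact hodd
    have hmod := norm_add_four_mul_emod_eight x y
    have hx2' : (x + 4 * y).norm % 2 = 1 := by
      have h8 : (2 : ℤ) ∣ 8 := by norm_num
      rw [← Int.emod_emod_of_dvd _ h8, hmod, Int.emod_emod_of_dvd _ h8, hx2]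
    have hodd1 : Odd (x + 4 * y).norm.natAbs := Int.natAbs_odd.mpr (Int.odd_iff.mpr hx2')
    have hodd2 : Odd x.norm.natAbs := Int.natAbs_odd.mpr (Int.odd_iff.mpr hx2)
    rw [jacobiSym.mod_right _ hodd1, jacobiSym.mod_right _ hodd2]
    congr 1
    have h0 : 0 ≤ (x + 4 * y).norm := GaussianInt.norm_nonneg _
    have h0' : 0 ≤ x.norm := GaussianInt.norm_nonneg _
    apply Nat.cast_injective (R := ℤ)
    push_cast
    rw [abs_of_nonneg h0, abs_of_nonneg h0']
    exact hmod
  · have heven : (x.re + x.im) % 2 = 0 := by omega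
    have heven' : ((x + 4 * y).re + (x + 4 * y).im) % 2 = 0 := by
      simp only [Zsqrtd.re_add, Zsqrtd.im_add, Zsqrtd.re_mul, Zsqrtd.im_mul]
      have h1 : (4 : ℤ[i]).re = 4 := rfl
      have h2 : (4 : ℤ[i]).im = 0 := rfl
      rw [h1, h2]
      omega
    rw [primaryUnit_eq_zero_of_even heven]
    simp

/-- `ψ₁ = heckePsi 1` is periodic modulo `4` (`GaussianPrimary.heckePsi_add_mul` with `4·1 = 4`).
[folklore] -/
theorem heckePsi_one_add_four_mul (x y : ℤ[i]) :
    heckePsi 1 (x + ((4 : ℕ) : ℤ[i]) * y) = heckePsi 1 x := by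
  have := heckePsi_add_mul 1 x y
  simpa using this

/-! ### The values of `ψ₁`, `ψ₂` on the sixteen classes modulo `4` -/

/-- `heckePsi n ⟨a, b⟩` through `N = a² + b²`. [folklore] -/
theorem heckePsi_mk (n : ℕ) (a b : ℤ) :
    heckePsi n ⟨a, b⟩ = ((jacobiSym n (a * a + b * b).natAbs : ℤ) : ℂ) *
      ((primaryUnit ⟨a, b⟩ : ℤ[i]) : ℂ) := by
  rw [heckePsi, Zsqrtd.norm_def]
  simp only []
  congr 4
  ring

/-- The unit parts of the eight odd classes modulo `4`. [folklore] -/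
theorem primaryUnit_values :
    primaryUnit ⟨1, 0⟩ = 1 ∧ primaryUnit ⟨3, 0⟩ = -1 ∧ primaryUnit ⟨0, 1⟩ = -⟨0, 1⟩ ∧
      primaryUnit ⟨0, 3⟩ = ⟨0, 1⟩ ∧ primaryUnit ⟨1, 2⟩ = -1 ∧ primaryUnit ⟨3, 2⟩ = 1 ∧
      primaryUnit ⟨2, 1⟩ = ⟨0, 1⟩ ∧ primaryUnit ⟨2, 3⟩ = -⟨0, 1⟩ := by
  refine ⟨?_, ?_, ?_, ?_, ?_, ?_, ?_, ?_⟩ <;> decide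

/-- The unit parts of the eight even classes modulo `4` vanish. [folklore] -/
theorem primaryUnit_values_even :
    primaryUnit ⟨0, 0⟩ = 0 ∧ primaryUnit ⟨1, 1⟩ = 0 ∧ primaryUnit ⟨2, 0⟩ = 0 ∧
      primaryUnit ⟨0, 2⟩ = 0 ∧ primaryUnit ⟨2, 2⟩ = 0 ∧ primaryUnit ⟨1, 3⟩ = 0 ∧
      primaryUnit ⟨3, 1⟩ = 0 ∧ primaryUnit ⟨3, 3⟩ = 0 := by
  refine ⟨?_, ?_, ?_, ?_, ?_, ?_, ?_, ?_⟩ <;> decide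

/-- `((⟨0, 1⟩ : ℤ[i]) : ℂ) = i`. [folklore] -/
theorem toComplex_I : ((⟨0, 1⟩ : ℤ[i]) : ℂ) = I := by
  rw [GaussianInt.toComplex_def']; simp

/-- **The values of `ψ₂` on the sixteen classes modulo `4`** (`ψ₂ = (2/N(x)) u(x)`;
`(2/5) = (2/13) = -1`). [folklore] -/
theorem heckePsi_two_values :
    heckePsi 2 ⟨1, 0⟩ = 1 ∧ heckePsi 2 ⟨3, 0⟩ = -1 ∧ heckePsi 2 ⟨0, 1⟩ = -I ∧
      heckePsi 2 ⟨0, 3⟩ = I ∧ heckePsi 2 ⟨1, 2⟩ = 1 ∧ heckePsi 2 ⟨3, 2⟩ = -1 ∧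
      heckePsi 2 ⟨2, 1⟩ = -I ∧ heckePsi 2 ⟨2, 3⟩ = I ∧
    heckePsi 2 ⟨0, 0⟩ = 0 ∧ heckePsi 2 ⟨1, 1⟩ = 0 ∧ heckePsi 2 ⟨2, 0⟩ = 0 ∧
      heckePsi 2 ⟨0, 2⟩ = 0 ∧ heckePsi 2 ⟨2, 2⟩ = 0 ∧ heckePsi 2 ⟨1, 3⟩ = 0 ∧
      heckePsi 2 ⟨3, 1⟩ = 0 ∧ heckePsi 2 ⟨3, 3⟩ = 0 := by
  obtain ⟨u1, u2, u3, u4, u5, u6, u7, u8⟩ := primaryUnit_values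
  obtain ⟨e1, e2, e3, e4, e5, e6, e7, e8⟩ := primaryUnit_values_even
  simp only [heckePsi_mk, u1, u2, u3, u4, u5, u6, u7, u8, e1, e2, e3, e4, e5, e6, e7, e8,
    map_one, map_neg, map_zero, toComplex_I, mul_zero]
  norm_num

/-- **The values of `ψ₁ = u` on the sixteen classes modulo `4`.** [folklore] -/
theorem heckePsi_one_values :
    heckePsi 1 ⟨1, 0⟩ = 1 ∧ heckePsi 1 ⟨3, 0⟩ = -1 ∧ heckePsi 1 ⟨0, 1⟩ = -I ∧
      heckePsi 1 ⟨0, 3⟩ = I ∧ heckePsi 1 ⟨1, 2⟩ = -1 ∧ heckePsi 1 ⟨3, 2⟩ = 1 ∧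
      heckePsi 1 ⟨2, 1⟩ = I ∧ heckePsi 1 ⟨2, 3⟩ = -I ∧
    heckePsi 1 ⟨0, 0⟩ = 0 ∧ heckePsi 1 ⟨1, 1⟩ = 0 ∧ heckePsi 1 ⟨2, 0⟩ = 0 ∧
      heckePsi 1 ⟨0, 2⟩ = 0 ∧ heckePsi 1 ⟨2, 2⟩ = 0 ∧ heckePsi 1 ⟨1, 3⟩ = 0 ∧
      heckePsi 1 ⟨3, 1⟩ = 0 ∧ heckePsi 1 ⟨3, 3⟩ = 0 := by
  obtain ⟨u1, u2, u3, u4, u5, u6, u7, u8⟩ := primaryUnit_values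
  obtain ⟨e1, e2, e3, e4, e5, e6, e7, e8⟩ := primaryUnit_values_even
  simp only [heckePsi_mk, u1, u2, u3, u4, u5, u6, u7, u8, e1, e2, e3, e4, e5, e6, e7, e8,
    map_one, map_neg, map_zero, toComplex_I, mul_zero]
  norm_num

/-! ### The eight Eisenstein–Kronecker numbers at the odd quarter classes -/

/-- The values of `E₁* = kroneckerE₁` at the eight odd classes of `¼Λ/Λ`, reduced to the two
primary ones `B₁ = E₁*(1/4)`, `B₂ = E₁*((3+2i)/4)` by `E₁*(iz) = −iE₁*(z)`, oddness and
`Λ`-periodicity. [folklore] -/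
theorem kroneckerE₁_quarter_classes :
    kroneckerE₁ ((3 : ℂ) / 4) = -kroneckerE₁ (1 / 4) ∧
    kroneckerE₁ (I / 4) = -I * kroneckerE₁ (1 / 4) ∧
    kroneckerE₁ (3 * I / 4) = I * kroneckerE₁ (1 / 4) ∧
    kroneckerE₁ ((1 + 2 * I) / 4) = -kroneckerE₁ ((3 + 2 * I) / 4) ∧
    kroneckerE₁ ((2 + I) / 4) = I * kroneckerE₁ ((3 + 2 * I) / 4) ∧
    kroneckerE₁ ((2 + 3 * I) / 4) = -I * kroneckerE₁ ((3 + 2 * I) / 4) := by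
  have h3 : kroneckerE₁ ((3 : ℂ) / 4) = -kroneckerE₁ (1 / 4) := by
    rw [show ((3 : ℂ) / 4) = -(1 / 4) + 1 by norm_num, kroneckerE₁_add_one, kroneckerE₁_neg]
  refine ⟨h3, ?_, ?_, ?_, ?_, ?_⟩
  · rw [show (I / 4 : ℂ) = I * (1 / 4) by ring, kroneckerE₁_I_mul]
  · rw [show (3 * I / 4 : ℂ) = I * (3 / 4) by ring, kroneckerE₁_I_mul, h3]; ring
  · rw [show ((1 + 2 * I) / 4 : ℂ) = -((3 + 2 * I) / 4) + (1 + I) by ring,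
      kroneckerE₁_add_of_mem _ one_add_I_mem, kroneckerE₁_neg]
  · have h1 : kroneckerE₁ (I * ((2 + I) / 4)) = -I * kroneckerE₁ ((2 + I) / 4) :=
      kroneckerE₁_I_mul _
    have h2 : I * ((2 + I) / 4) = (3 + 2 * I) / 4 + (-1) := by linear_combination I_sq / 4
    rw [h2, show ((3 + 2 * I) / 4 + (-1) : ℂ) = ((3 + 2 * I) / 4 - 1) by ring] at h1
    have h4 := kroneckerE₁_add_one ((3 + 2 * I) / 4 - 1)
    rw [sub_add_cancel] at h4
    rw [← h4] at h1
    linear_combination (-I) * h1 + kroneckerE₁ ((2 + I) / 4) * I_sq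
  · have h1 : kroneckerE₁ (I * ((2 + 3 * I) / 4)) = -I * kroneckerE₁ ((2 + 3 * I) / 4) :=
      kroneckerE₁_I_mul _
    have h2 : I * ((2 + 3 * I) / 4) = -((3 + 2 * I) / 4 - I) := by linear_combination 3 * I_sq / 4
    rw [h2, kroneckerE₁_neg] at h1
    have h4 := kroneckerE₁_add_I ((3 + 2 * I) / 4 - I)
    rw [sub_add_cancel] at h4
    rw [← h4] at h1
    linear_combination (-I) * h1 + kroneckerE₁ ((2 + 3 * I) / 4) * I_sq

/-! ### The sum over the sixteen classes modulo `4` -/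

/-- `Finset.univ` of `ZMod 4`. [folklore] -/
theorem univ_zmod_four : (Finset.univ : Finset (ZMod 4)) = {0, 1, 2, 3} := by decide

/-- Expansion of a sum over `ZMod 4`. [folklore] -/
theorem sum_univ_zmod_four (g : ZMod 4 → ℂ) : ∑ a : ZMod 4, g a = g 0 + g 1 + g 2 + g 3 := by
  rw [univ_zmod_four, Finset.sum_insert (by decide), Finset.sum_insert (by decide),
    Finset.sum_insert (by decide), Finset.sum_singleton]
  ring

/-- Expansion of a sum over `ℤ[i]/4` into its sixteen representatives. [folklore] -/
theorem sum_zmod_four_prod (f : ZMod 4 × ZMod 4 → ℂ) :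
    ∑ c : ZMod 4 × ZMod 4, f c =
      f (0, 0) + f (0, 1) + f (0, 2) + f (0, 3) + (f (1, 0) + f (1, 1) + f (1, 2) + f (1, 3)) +
      (f (2, 0) + f (2, 1) + f (2, 2) + f (2, 3)) + (f (3, 0) + f (3, 1) + f (3, 2) + f (3, 3)) := by
  rw [Fintype.sum_prod_type, sum_univ_zmod_four]
  simp only [sum_univ_zmod_four]

/-- The representatives `rep 4 (a, b) 0 = ⟨a, b⟩`. [folklore] -/
theorem rep_four_values :
    rep 4 ((0 : ZMod 4), (0 : ZMod 4)) 0 = ⟨0, 0⟩ ∧ rep 4 ((0 : ZMod 4), (1 : ZMod 4)) 0 = ⟨0, 1⟩ ∧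
    rep 4 ((0 : ZMod 4), (2 : ZMod 4)) 0 = ⟨0, 2⟩ ∧ rep 4 ((0 : ZMod 4), (3 : ZMod 4)) 0 = ⟨0, 3⟩ ∧
    rep 4 ((1 : ZMod 4), (0 : ZMod 4)) 0 = ⟨1, 0⟩ ∧ rep 4 ((1 : ZMod 4), (1 : ZMod 4)) 0 = ⟨1, 1⟩ ∧
    rep 4 ((1 : ZMod 4), (2 : ZMod 4)) 0 = ⟨1, 2⟩ ∧ rep 4 ((1 : ZMod 4), (3 : ZMod 4)) 0 = ⟨1, 3⟩ ∧
    rep 4 ((2 : ZMod 4), (0 : ZMod 4)) 0 = ⟨2, 0⟩ ∧ rep 4 ((2 : ZMod 4), (1 : ZMod 4)) 0 = ⟨2, 1⟩ ∧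
    rep 4 ((2 : ZMod 4), (2 : ZMod 4)) 0 = ⟨2, 2⟩ ∧ rep 4 ((2 : ZMod 4), (3 : ZMod 4)) 0 = ⟨2, 3⟩ ∧
    rep 4 ((3 : ZMod 4), (0 : ZMod 4)) 0 = ⟨3, 0⟩ ∧ rep 4 ((3 : ZMod 4), (1 : ZMod 4)) 0 = ⟨3, 1⟩ ∧
    rep 4 ((3 : ZMod 4), (2 : ZMod 4)) 0 = ⟨3, 2⟩ ∧ rep 4 ((3 : ZMod 4), (3 : ZMod 4)) 0 = ⟨3, 3⟩ := by
  refine ⟨?_, ?_, ?_, ?_, ?_, ?_, ?_, ?_, ?_, ?_, ?_, ?_, ?_, ?_, ?_, ?_⟩ <;> decide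

/-- **The Kronecker sum for `ψ₂`**: `∑_{c mod 4} ψ₂(c) conj(E₁*(c/4)) = 4√2 ϖ₀`
(four classes in the unit orbit of `1` contribute `conj E₁*(1/4)` each, the four in the orbit of
`3 + 2i` contribute `−conj E₁*((3+2i)/4)` each; `E₁*(1/4) − E₁*((3+2i)/4) = √2ϖ₀`).
[folklore] -/
theorem sum_heckePsi_two_mul_conj_kroneckerE₁ :
    ∑ c : ZMod 4 × ZMod 4, heckePsi 2 (rep 4 c 0) * conj (kroneckerE₁ ((rep 4 c 0 : ℂ) / 4)) =
      4 * (Real.sqrt 2 : ℂ) * ((ϖ₀ : ℝ) : ℂ) := by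
  obtain ⟨r00, r01, r02, r03, r10, r11, r12, r13, r20, r21, r22, r23, r30, r31, r32, r33⟩ :=
    rep_four_values
  obtain ⟨v10, v30, v01, v03, v12, v32, v21, v23, v00, v11, v20, v02, v22, v13, v31, v33⟩ :=
    heckePsi_two_values
  obtain ⟨k3, kI, k3I, k12, k21, k23⟩ := kroneckerE₁_quarter_classes
  have hsub := kroneckerE₁_quarter_add_sub.2
  rw [sum_zmod_four_prod]
  simp only [r00, r01, r02, r03, r10, r11, r12, r13, r20, r21, r22, r23, r30, r31, r32, r33,
    v10, v30, v01, v03, v12, v32, v21, v23, v00, v11, v20, v02, v22, v13, v31, v33,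
    zero_mul, add_zero, zero_add]
  simp only [GaussianInt.toComplex_def', Int.cast_zero, Int.cast_one, Int.cast_ofNat, zero_mul,
    add_zero, zero_add, one_mul]
  rw [k3, kI, k3I, k12, k21, k23]
  -- the two base values are real
  set B₁ := kroneckerE₁ (1 / 4) with hB₁
  set B₂ := kroneckerE₁ ((3 + 2 * I) / 4) with hB₂
  have hB₁r : conj B₁ = B₁ := by
    rw [hB₁, kroneckerE₁_quarter]; simp [map_ofNat]
  have hB₂r : conj B₂ = B₂ := by
    rw [hB₂, kroneckerE₁_three_add_two_I_quarter]; simp [map_ofNat]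
  simp only [map_neg, map_mul, Complex.conj_I, hB₁r, hB₂r]
  linear_combination 4 * hsub + (-2 * B₁ + 2 * B₂) * I_sq

/-- **The Kronecker sum for `ψ₁`**: `∑_{c mod 4} ψ₁(c) conj(E₁*(c/4)) = 4ϖ₀`. [folklore] -/
theorem sum_heckePsi_one_mul_conj_kroneckerE₁ :
    ∑ c : ZMod 4 × ZMod 4, heckePsi 1 (rep 4 c 0) * conj (kroneckerE₁ ((rep 4 c 0 : ℂ) / 4)) =
      4 * ((ϖ₀ : ℝ) : ℂ) := by
  obtain ⟨r00, r01, r02, r03, r10, r11, r12, r13, r20, r21, r22, r23, r30, r31, r32, r33⟩ :=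
    rep_four_values
  obtain ⟨v10, v30, v01, v03, v12, v32, v21, v23, v00, v11, v20, v02, v22, v13, v31, v33⟩ :=
    heckePsi_one_values
  obtain ⟨k3, kI, k3I, k12, k21, k23⟩ := kroneckerE₁_quarter_classes
  have hadd := kroneckerE₁_quarter_add_sub.1
  rw [sum_zmod_four_prod]
  simp only [r00, r01, r02, r03, r10, r11, r12, r13, r20, r21, r22, r23, r30, r31, r32, r33,
    v10, v30, v01, v03, v12, v32, v21, v23, v00, v11, v20, v02, v22, v13, v31, v33,
    zero_mul, add_zero, zero_add]
  simp only [GaussianInt.toComplex_def', Int.cast_zero, Int.cast_one, Int.cast_ofNat, zero_mul,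
    add_zero, zero_add, one_mul]
  rw [k3, kI, k3I, k12, k21, k23]
  set B₁ := kroneckerE₁ (1 / 4) with hB₁
  set B₂ := kroneckerE₁ ((3 + 2 * I) / 4) with hB₂
  have hB₁r : conj B₁ = B₁ := by
    rw [hB₁, kroneckerE₁_quarter]; simp [map_ofNat]
  have hB₂r : conj B₂ = B₂ := by
    rw [hB₂, kroneckerE₁_three_add_two_I_quarter]; simp [map_ofNat]
  simp only [map_neg, map_mul, Complex.conj_I, hB₁r, hB₂r]
  linear_combination 4 * hadd + (-2 * B₁ - 2 * B₂) * I_sq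

/-! ### The two `L`-values -/

/-- **`L(E₂, 1) = β/(2√2)`** for `E₂ : y² = x³ − 4x`, `β = ∫₁^∞ dx/√(x³ − x)` (Birch–Swinnerton-Dyer
1965, Table 1, read as in Tunnell 1983, p. 329: the case `d = 1` of Theorem 3's
`L(E^{2d}, 1) = b(d)²β(2d)^{-1/2}/2`). Proof: `L(E₂, 1) = (1/16) ∑_{c mod 4} ψ₂(c) conj E₁*(c/4)`
(`entireLFunction_congruentNumberCurve_one_eq_sum`, `ψ₂` being `4`-periodic) `= 4√2ϖ₀/16 =
ϖ₀/(2√2)` and `β = ϖ₀`. [cite: Tunnell1983Congruent, proof of Thm 3, p. 329]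
[cite: BirchSwinnertonDyer1965NotesII, Table 1] -/
theorem entireLFunction_congruentNumberCurve_two_one :
    (congruentNumberCurve 2).entireLFunction 1 = ((tunnellPeriod / (2 * Real.sqrt 2) : ℝ) : ℂ) := by
  rw [entireLFunction_congruentNumberCurve_one_eq_sum Nat.squarefree_two 4 heckePsi_two_add_four_mul]
  simp only [Nat.cast_ofNat]
  rw [sum_heckePsi_two_mul_conj_kroneckerE₁, tunnellPeriod_eq_varpi]
  have hs : (Real.sqrt 2 : ℂ) ≠ 0 := Complex.ofReal_ne_zero.mpr (by positivity)
  have hs2 : (Real.sqrt 2 : ℂ) ^ 2 = 2 := by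
    rw [← Complex.ofReal_pow, Real.sq_sqrt (by norm_num)]; push_cast; ring
  push_cast
  field_simp
  linear_combination 2 * ((Real.Gamma (1 / 4) : ℝ) : ℂ) ^ 2 * hs2

/-- **`L(E₁, 1) = β/4`** for `E₁ : y² = x³ − x` (Birch–Swinnerton-Dyer 1965, Table 1: `L(E, 1)/β = 1/4`,
as quoted by Tunnell 1983, p. 329). Proof: `L(E₁, 1) = (1/16) ∑_{c mod 4} u(c) conj E₁*(c/4) = 4ϖ₀/16`.
[cite: Tunnell1983Congruent, proof of Thm 3, p. 329] [cite: BirchSwinnertonDyer1965NotesII, Table 1] -/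
theorem entireLFunction_congruentNumberCurve_one_one :
    (congruentNumberCurve 1).entireLFunction 1 = ((tunnellPeriod / 4 : ℝ) : ℂ) := by
  rw [entireLFunction_congruentNumberCurve_one_eq_sum squarefree_one 4 heckePsi_one_add_four_mul]
  simp only [Nat.cast_ofNat]
  rw [sum_heckePsi_one_mul_conj_kroneckerE₁, tunnellPeriod_eq_varpi]
  push_cast
  ring

/-- **The `E₂`-half of `BirchSwinnertonDyer1965_L_one_two_ten`, discharged.** [folklore] -/
theorem BirchSwinnertonDyer1965_L_one_two :
    ((congruentNumberCurve 2).HasEntireLFunction →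
      (congruentNumberCurve 2).entireLFunction 1 = ((tunnellPeriod / (2 * Real.sqrt 2) : ℝ) : ℂ)) :=
  fun _ ↦ entireLFunction_congruentNumberCurve_two_one

/-- **The `E₁`-half of `BirchSwinnertonDyer1965_L_one_one_three`, discharged.** [folklore] -/
theorem BirchSwinnertonDyer1965_L_one_one :
    ((congruentNumberCurve 1).HasEntireLFunction →
      (congruentNumberCurve 1).entireLFunction 1 = ((tunnellPeriod / 4 : ℝ) : ℂ)) :=
  fun _ ↦ entireLFunction_congruentNumberCurve_one_one

end Literature.NumberTheory.EllipticCurves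

end
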